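import Mathlib.Probability.Martingale.Basic
import Mathlib.MeasureTheory.Function.ConditionalExpectation.PullOut
import Literature.Probability.Process.SimpleProcessAlgebra
import Literature.Probability.RandomPlanarGeometry.LocalMartingaleProofs
import HarnessLib

/-!
# Elementary stochastic integrals are square-integrable martingales; the Itô isometry

For a bounded simple process `H` (`Literature.SimpleProcess m 𝓕`) and an integrator `B` which is a
square-integrable `𝓕`-martingale, the elementary stochastic integral
`(H · B)_t = ∑ᵢ Hᵢ (B_{t ∧ tᵢ₊₁} - B_{t ∧ tᵢ})` (`SimpleProcess.integral`) is

* strongly adapted (`SimpleProcess.stronglyMeasurable_integral`), square integrable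
  (`SimpleProcess.memLp_integral`) and an `𝓕`-martingale (`SimpleProcess.martingale_integral`);
* if moreover `B_t² - t` is a martingale (i.e. `⟨B⟩_t = t`), the **Itô isometry** holds:
  `E[(H · B)_t²] = E[∑ᵢ Hᵢ² (t ∧ tᵢ₊₁ - t ∧ tᵢ)] = E[∫₀ᵗ H(s)² ds]`
  (`SimpleProcess.integral_integral_sq`, `SimpleProcess.integral_integral_sq_eq_setIntegral`).

Everything is generic in `(Ω, 𝓕, μ, B)` (finite measure). Specialised to the canonical Brownian
motion `Literature.Probability.Process.brownian`, its raw natural filtration and the pre-Wiener measure (the martingale facts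
`martingale_brownian_holds`, `martingale_brownian_sq_sub_holds` of `LocalMartingaleProofs`) this
gives `SimpleProcess.martingale_integral_brownian` and `SimpleProcess.memLp_integral_brownian`;
the discharge `Literature.Probability.Process.itoIsometry_simple_holds` of the named fact `Literature.Probability.Process.itoIsometry_simple` lives in
`ItoCalculusProofs.lean` (Brownian-specific proof) and is not duplicated here.

## References

* D. Revuz, M. Yor, *Continuous Martingales and Brownian Motion* (3rd ed., 1999), Ch. IV, §2:
  the elementary stochastic integral after Def. (2.3) ("`H²`-martingale") and the isometry
  `E[(K·M)_∞²] = ‖K‖²_M` in the proof of Thm (2.2) (p. 138, "orthogonality of martingale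
  increments").
* K. Itô, *Stochastic integral*, Proc. Imp. Acad. Tokyo 20 (1944), 519–524.
-/

open MeasureTheory ProbabilityTheory Filter Finset
open scoped NNReal ENNReal Topology

namespace Literature.Probability.Process

variable {Ω : Type*} {m : MeasurableSpace Ω} {𝓕 : Filtration ℝ≥0 m} {μ : Measure Ω}

/-! ### Two generic martingale lemmas -/

/-- A martingale stopped at a deterministic time is a martingale: `r ↦ B_{r ∧ c}`.
Revuz–Yor, *Continuous Martingales and Brownian Motion* (1999), Ch. II, Thm (3.3) (trivial
deterministic case). [folklore] -/
theorem martingale_min_const [IsFiniteMeasure μ] {B : ℝ≥0 → Ω → ℝ} (hB : Martingale B 𝓕 μ)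
    (c : ℝ≥0) :
    Martingale (fun r ↦ B (min r c)) 𝓕 μ := by
  refine ⟨fun r ↦ (hB.stronglyAdapted (min r c)).mono (𝓕.mono (min_le_left _ _)), ?_⟩
  intro s r hsr
  rcases le_total s c with hsc | hcs
  · -- `s ≤ c`: `s ≤ r ∧ c`, martingale property
    have h := hB.condExp_ae_eq (le_min hsr hsc)
    simpa only [min_eq_left hsc] using h
  · -- `c ≤ s`: `B_{r ∧ c} = B_c` is `𝓕 s`-measurable
    have hrc : min r c = c := min_eq_right (hcs.trans hsr)
    have hsc : min s c = c := min_eq_right hcs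
    simp only [hrc, hsc]
    have hmeas : StronglyMeasurable[𝓕 s] (B c) := (hB.stronglyAdapted c).mono (𝓕.mono hcs)
    rw [condExp_of_stronglyMeasurable (𝓕.le s) hmeas (hB.integrable c)]

/-- **Freezing a bounded `𝓕ₐ`-measurable factor**: if `D` is a martingale vanishing identically
up to time `a` and `ξ` is bounded and `𝓕 a`-measurable, then `r ↦ ξ · D_r` is a martingale
(pull-out property after time `a`, tower property before).
Revuz–Yor, *Continuous Martingales and Brownian Motion* (1999), Ch. IV, §2, the elementary
stochastic integral after Def. (2.3). [folklore] -/
theorem martingale_mul_of_eq_zero [IsFiniteMeasure μ] {D : ℝ≥0 → Ω → ℝ} {ξ : Ω → ℝ} {a : ℝ≥0}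
    (hD : Martingale D 𝓕 μ) (hD0 : ∀ r ≤ a, D r = 0) (hξ : StronglyMeasurable[𝓕 a] ξ)
    (hξbdd : ∃ C, ∀ ω, |ξ ω| ≤ C) : Martingale (fun r ω ↦ ξ ω * D r ω) 𝓕 μ := by
  obtain ⟨C, hC⟩ := hξbdd
  have hξm : StronglyMeasurable ξ := hξ.mono (𝓕.le a)
  have hint : ∀ r, Integrable (fun ω ↦ ξ ω * D r ω) μ := fun r ↦
    (hD.integrable r).bdd_mul hξm.aestronglyMeasurable
      (ae_of_all _ fun ω ↦ by simpa [Real.norm_eq_abs] using hC ω)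
  -- after time `a`, the factor can be pulled out
  have hafter : ∀ s r, a ≤ s → s ≤ r →
      μ[fun ω ↦ ξ ω * D r ω | 𝓕 s] =ᵐ[μ] fun ω ↦ ξ ω * D s ω := by
    intro s r has hsr
    have hξs : StronglyMeasurable[𝓕 s] ξ := hξ.mono (𝓕.mono has)
    have h1 := condExp_mul_of_stronglyMeasurable_left (μ := μ) hξs (hint r) (hD.integrable r)
    filter_upwards [h1, hD.condExp_ae_eq hsr] with ω hω hω'
    rw [show (fun ω ↦ ξ ω * D r ω) = ξ * D r from rfl, hω, Pi.mul_apply, hω']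
  refine ⟨fun r ↦ ?_, fun s r hsr ↦ ?_⟩
  · -- adapted
    show StronglyMeasurable[𝓕 r] (fun ω ↦ ξ ω * D r ω)
    rcases le_or_gt r a with hra | har
    · have : (fun ω ↦ ξ ω * D r ω) = 0 := by ext ω; simp [hD0 r hra]
      rw [this]
      exact stronglyMeasurable_zero
    · exact (hξ.mono (𝓕.mono har.le)).mul (hD.stronglyAdapted r)
  · show μ[fun ω ↦ ξ ω * D r ω | 𝓕 s] =ᵐ[μ] fun ω ↦ ξ ω * D s ω
    rcases le_or_gt a s with has | hsa
    · exact hafter s r has hsr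
    · -- `s < a`
      have hs0 : (fun ω ↦ ξ ω * D s ω) = 0 := by ext ω; simp [hD0 s hsa.le]
      rcases le_or_gt r a with hra | har
      · have hr0 : (fun ω ↦ ξ ω * D r ω) = 0 := by ext ω; simp [hD0 r hra]
        rw [hr0, hs0]
        exact condExp_zero.eventuallyEq
      · -- tower through `𝓕 a`, where the conditional expectation is `ξ D_a = 0`
        have ha0 : (fun ω ↦ ξ ω * D a ω) = 0 := by ext ω; simp [hD0 a le_rfl]
        have htower := (condExp_condExp_of_le (𝓕.mono hsa.le) (𝓕.le a)
          (μ := μ) (f := fun ω ↦ ξ ω * D r ω)).symm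
        have hinner : μ[fun ω ↦ ξ ω * D r ω | 𝓕 a] =ᵐ[μ] 0 := by
          have := hafter a r le_rfl har.le
          rwa [ha0] at this
        rw [hs0]
        refine htower.trans ?_
        refine (condExp_congr_ae hinner).trans ?_
        exact condExp_zero.eventuallyEq

/-- **Second moment of martingale increments from the quadratic martingale**: if `B` and
`B_t² - t` are martingales and `B_t ∈ L²`, then `E[(B_u - B_a)² | 𝓕 a] = u - a` for `a ≤ u`.
Revuz–Yor, *Continuous Martingales and Brownian Motion* (1999), Ch. II, Prop. (1.2)(ii) and
Ch. IV, Thm (1.8). [folklore] -/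
theorem condExp_sub_sq_of_martingale_sq_sub [IsFiniteMeasure μ] {B : ℝ≥0 → Ω → ℝ}
    (hB : Martingale B 𝓕 μ) (hBsq : Martingale (fun t ω ↦ B t ω ^ 2 - (t : ℝ)) 𝓕 μ)
    (hB2 : ∀ t, MemLp (B t) 2 μ) {a u : ℝ≥0} (hau : a ≤ u) :
    μ[fun ω ↦ (B u ω - B a ω) ^ 2 | 𝓕 a] =ᵐ[μ] fun _ ↦ (u : ℝ) - a := by
  -- `(B_u - B_a)² = (B_u² - u) - 2 B_a B_u + (B_a² + u)`
  have hBa : StronglyMeasurable[𝓕 a] (B a) := hB.stronglyAdapted a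
  have hBu2 : Integrable (fun ω ↦ B u ω ^ 2) μ := (hB2 u).integrable_sq
  have hBaBu : Integrable (B a * B u) μ := (hB2 a).integrable_mul (hB2 u)
  have hdec : (fun ω ↦ (B u ω - B a ω) ^ 2) =
      (fun ω ↦ B u ω ^ 2 - (u : ℝ)) - (2 : ℝ) • (B a * B u) + fun ω ↦ B a ω ^ 2 + (u : ℝ) := by
    ext ω
    simp only [Pi.add_apply, Pi.sub_apply, Pi.smul_apply, Pi.mul_apply, smul_eq_mul]
    ring
  have h1 : μ[fun ω ↦ B u ω ^ 2 - (u : ℝ) | 𝓕 a] =ᵐ[μ] fun ω ↦ B a ω ^ 2 - (a : ℝ) :=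
    hBsq.condExp_ae_eq hau
  have h2 : μ[B a * B u | 𝓕 a] =ᵐ[μ] fun ω ↦ B a ω ^ 2 := by
    have := condExp_mul_of_stronglyMeasurable_left (μ := μ) hBa hBaBu (hB.integrable u)
    filter_upwards [this, hB.condExp_ae_eq hau] with ω hω hω'
    rw [hω, Pi.mul_apply, hω', sq]
  have h3int : Integrable (fun ω ↦ B a ω ^ 2 + (u : ℝ)) μ :=
    (hB2 a).integrable_sq.add (integrable_const _)
  have h3 : μ[fun ω ↦ B a ω ^ 2 + (u : ℝ) | 𝓕 a] = fun ω ↦ B a ω ^ 2 + (u : ℝ) :=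
    condExp_of_stronglyMeasurable (𝓕.le a) ((hBa.pow 2).add stronglyMeasurable_const) h3int
  have hA := condExp_sub (hBsq.integrable u) (hBaBu.smul (2 : ℝ)) (𝓕 a) (μ := μ)
  have hB' := condExp_add ((hBsq.integrable u).sub (hBaBu.smul (2 : ℝ))) h3int (𝓕 a) (μ := μ)
  have hS := condExp_smul (2 : ℝ) (B a * B u) (𝓕 a) (μ := μ)
  rw [hdec]
  filter_upwards [hA, hB', hS, h1, h2] with ω hAω hBω hSω h1ω h2ω
  rw [hBω, Pi.add_apply, hAω, Pi.sub_apply, hSω, Pi.smul_apply, h1ω, h2ω, h3, smul_eq_mul]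
  ring

/-- Bounded times square-integrable is square-integrable. [folklore] -/
theorem memLp_two_bdd_mul {ξ Z : Ω → ℝ} (hξm : AEStronglyMeasurable ξ μ) {C : ℝ}
    (hC : ∀ ω, |ξ ω| ≤ C) (hZ : MemLp Z 2 μ) : MemLp (fun ω ↦ ξ ω * Z ω) 2 μ := by
  rw [memLp_two_iff_integrable_sq
    (show AEStronglyMeasurable (fun ω ↦ ξ ω * Z ω) μ from hξm.mul hZ.aestronglyMeasurable)]
  have heq : (fun ω ↦ (ξ ω * Z ω) ^ 2) = fun ω ↦ ξ ω ^ 2 * Z ω ^ 2 := by ext ω; ring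
  rw [heq]
  refine hZ.integrable_sq.bdd_mul (hξm.pow 2) (c := C ^ 2) (ae_of_all _ fun ω ↦ ?_)
  rw [Real.norm_eq_abs, abs_pow, sq_abs]
  have h0 : 0 ≤ C := (abs_nonneg _).trans (hC ω)
  nlinarith [hC ω, abs_nonneg (ξ ω), sq_abs (ξ ω)]

namespace SimpleProcess

variable {B : ℝ≥0 → Ω → ℝ}

/-! ### Adaptedness and square integrability of the elementary integral -/

/-- The `i`-th summand `Hᵢ (B_{r ∧ tᵢ₊₁} - B_{r ∧ tᵢ})` of the elementary integral at time `r`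
is `𝓕 (r ∧ tᵢ₊₁)`-measurable (it vanishes for `r ≤ tᵢ`).
Revuz–Yor, *Continuous Martingales and Brownian Motion* (1999), Ch. IV, §2, after Def. (2.3).
[folklore] -/
theorem stronglyMeasurable_summand (H : SimpleProcess m 𝓕) (hB : StronglyAdapted 𝓕 B) {i : ℕ}
    (hi : i + 1 < H.times.length) (r : ℝ≥0) :
    StronglyMeasurable[𝓕 (min r (H.time (i + 1)))] (H.summand B i r) := by
  rcases le_or_gt r (H.time i) with hr | hr
  · rw [H.summand_eq_zero_of_le B hi hr]
    exact stronglyMeasurable_zero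
  · rw [H.summand_eq_of_lt B hr]
    have hti : H.time i ≤ min r (H.time (i + 1)) :=
      le_min hr.le (H.time_mono (Nat.le_succ i) hi)
    exact ((H.stronglyMeasurable_value (by omega)).mono (𝓕.mono hti)).mul
      ((hB _).sub ((hB _).mono (𝓕.mono hti)))

/-- The summands of the elementary integral are adapted. [folklore] -/
theorem stronglyMeasurable_summand' (H : SimpleProcess m 𝓕) (hB : StronglyAdapted 𝓕 B)
    {i : ℕ} (hi : i + 1 < H.times.length) (r : ℝ≥0) :
    StronglyMeasurable[𝓕 r] (H.summand B i r) :=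
  (H.stronglyMeasurable_summand hB hi r).mono (𝓕.mono (min_le_left _ _))

/-- **The elementary integral is strongly adapted.**
Revuz–Yor, *Continuous Martingales and Brownian Motion* (1999), Ch. IV, §2, after Def. (2.3).
[folklore] -/
theorem stronglyMeasurable_integral (H : SimpleProcess m 𝓕) (hB : StronglyAdapted 𝓕 B)
    (r : ℝ≥0) : StronglyMeasurable[𝓕 r] (H.integral B r) := by
  rw [H.integral_eq_sum_summand B r]
  refine Finset.stronglyMeasurable_sum _ fun i hi ↦ ?_
  exact H.stronglyMeasurable_summand' hB (by have := mem_range.1 hi; omega) r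

/-- The elementary integral is strongly adapted (bundled). [folklore] -/
theorem stronglyAdapted_integral (H : SimpleProcess m 𝓕) (hB : StronglyAdapted 𝓕 B) :
    StronglyAdapted 𝓕 (H.integral B) :=
  fun r ↦ H.stronglyMeasurable_integral hB r

/-- The partial elementary integral over the first `n` summands at time `r` is
`𝓕 (tₙ)`-measurable (for `n + 1 ≤ length`): it only involves `B` up to time `r ∧ tₙ`.
[folklore] -/
theorem stronglyMeasurable_sum_summand (H : SimpleProcess m 𝓕) (hB : StronglyAdapted 𝓕 B)
    {n : ℕ} (hn : n < H.times.length) (r : ℝ≥0) :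
    StronglyMeasurable[𝓕 (H.time n)] (∑ i ∈ range n, H.summand B i r) := by
  refine Finset.stronglyMeasurable_sum _ fun i hi ↦ ?_
  have hi' : i + 1 < H.times.length := by have := mem_range.1 hi; omega
  exact (H.stronglyMeasurable_summand hB hi' r).mono
    (𝓕.mono ((min_le_right _ _).trans (H.time_mono (mem_range.1 hi) hn)))

/-- Each summand of the elementary integral is square integrable when `B` is. [folklore] -/
theorem memLp_summand (H : SimpleProcess m 𝓕)
    (hB2 : ∀ t, MemLp (B t) 2 μ) (i : ℕ) (hi : i < H.times.length) (r : ℝ≥0) :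
    MemLp (H.summand B i r) 2 μ := by
  obtain ⟨C, hC⟩ := H.bounded
  exact memLp_two_bdd_mul ((H.stronglyMeasurable_value' hi).aestronglyMeasurable)
    (fun ω ↦ hC i ω) ((hB2 _).sub (hB2 _))

/-- **The elementary integral is square integrable** when the integrator is.
Revuz–Yor, *Continuous Martingales and Brownian Motion* (1999), Ch. IV, §2. [folklore] -/
theorem memLp_integral (H : SimpleProcess m 𝓕)
    (hB2 : ∀ t, MemLp (B t) 2 μ) (r : ℝ≥0) : MemLp (H.integral B r) 2 μ := by
  rw [H.integral_eq_sum_summand B r]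
  refine memLp_finsetSum' _ fun i hi ↦ ?_
  exact H.memLp_summand hB2 i (by have := mem_range.1 hi; omega) r

/-- The partial sums of the elementary integral are square integrable. [folklore] -/
theorem memLp_sum_summand (H : SimpleProcess m 𝓕)
    (hB2 : ∀ t, MemLp (B t) 2 μ) {n : ℕ} (hn : n ≤ H.times.length) (r : ℝ≥0) :
    MemLp (∑ i ∈ range n, H.summand B i r) 2 μ := by
  refine memLp_finsetSum' _ fun i hi ↦ ?_
  exact H.memLp_summand hB2 i (by have := mem_range.1 hi; omega) r

/-! ### The martingale property -/

/-- Each summand process `r ↦ Hᵢ (B_{r ∧ tᵢ₊₁} - B_{r ∧ tᵢ})` of the elementary integral is a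
martingale (`B^{tᵢ₊₁} - B^{tᵢ}` is a martingale vanishing up to `tᵢ`, `Hᵢ` is bounded and
`𝓕 tᵢ`-measurable).
Revuz–Yor, *Continuous Martingales and Brownian Motion* (1999), Ch. IV, §2, after Def. (2.3).
[folklore] -/
theorem martingale_summand [IsFiniteMeasure μ] (H : SimpleProcess m 𝓕) (hB : Martingale B 𝓕 μ)
    {i : ℕ} (hi : i + 1 < H.times.length) : Martingale (fun r ↦ H.summand B i r) 𝓕 μ := by
  have hD : Martingale (fun r ω ↦ B (min r (H.time (i + 1))) ω - B (min r (H.time i)) ω) 𝓕 μ :=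
    (martingale_min_const hB _).sub (martingale_min_const hB _)
  have hD0 : ∀ r ≤ H.time i,
      (fun ω ↦ B (min r (H.time (i + 1))) ω - B (min r (H.time i)) ω) = 0 := by
    intro r hr
    have h1 : min r (H.time (i + 1)) = r := min_eq_left (hr.trans (H.time_mono (Nat.le_succ i) hi))
    have h2 : min r (H.time i) = r := min_eq_left hr
    ext ω; simp [h1, h2]
  have h := martingale_mul_of_eq_zero hD hD0 (H.stronglyMeasurable_value (by omega))
    (H.bounded.imp fun C hC ω ↦ hC i ω)
  exact h

/-- **The elementary stochastic integral is a martingale** (finite sum of martingales).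
Revuz–Yor, *Continuous Martingales and Brownian Motion* (1999), Ch. IV, §2, after Def. (2.3)
("it is easily seen that `H·X` is in `H²₀`"). [cite: RevuzYor1999, Ch. IV §2 Def. (2.3)ff] -/
theorem martingale_integral [IsFiniteMeasure μ] (H : SimpleProcess m 𝓕) (hB : Martingale B 𝓕 μ) :
    Martingale (H.integral B) 𝓕 μ := by
  have heq : H.integral B = fun r ↦ ∑ i ∈ range (H.times.length - 1), H.summand B i r :=
    funext fun r ↦ H.integral_eq_sum_summand B r
  rw [heq]
  -- induction over the number of summands
  suffices h : ∀ n, n + 1 ≤ H.times.length →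
      Martingale (fun r ↦ ∑ i ∈ range n, H.summand B i r) 𝓕 μ by
    rcases Nat.eq_zero_or_pos H.times.length with h0 | hpos
    · simp only [h0]
      exact martingale_zero _ _ _  -- hmm
    · exact h _ (by omega)
  intro n hn
  induction n with
  | zero =>
    simp only [range_zero, sum_empty]
    exact martingale_zero _ _ _
  | succ n ih =>
    have h1 := ih (by omega)
    have h2 := H.martingale_summand hB (i := n) (by omega)
    have h3 : (fun r ↦ ∑ i ∈ range (n + 1), H.summand B i r) =
        (fun r ↦ ∑ i ∈ range n, H.summand B i r) + fun r ↦ H.summand B n r := by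
      ext r ω; simp [sum_range_succ]
    rw [h3]
    exact h1.add h2

/-! ### The Itô isometry for simple integrands -/

section Isometry

variable [IsFiniteMeasure μ]

/-- The second moment of one summand: `E[Hₙ² (B_{t ∧ tₙ₊₁} - B_{t ∧ tₙ})²] =
E[Hₙ² (t ∧ tₙ₊₁ - t ∧ tₙ)]`.
Revuz–Yor, *Continuous Martingales and Brownian Motion* (1999), Ch. IV, proof of Thm (2.2).
[folklore] -/
theorem integral_summand_sq (H : SimpleProcess m 𝓕) (hB : Martingale B 𝓕 μ)
    (hBsq : Martingale (fun t ω ↦ B t ω ^ 2 - (t : ℝ)) 𝓕 μ) (hB2 : ∀ t, MemLp (B t) 2 μ)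
    {n : ℕ} (hn : n + 1 < H.times.length) (t : ℝ≥0) :
    ∫ ω, H.summand B n t ω ^ 2 ∂μ =
      ∫ ω, H.value n ω ^ 2 * ((min t (H.time (n + 1)) : ℝ≥0) - (min t (H.time n) : ℝ≥0) : ℝ) ∂μ := by
  rcases le_or_gt t (H.time n) with ht | ht
  · -- before `tₙ` both sides vanish
    have h1 : min t (H.time (n + 1)) = t := min_eq_left (ht.trans (H.time_mono (Nat.le_succ n) hn))
    have h2 : min t (H.time n) = t := min_eq_left ht
    simp [H.summand_eq_zero_of_le B hn ht, h1, h2]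
  · set a := H.time n with ha
    set u := min t (H.time (n + 1)) with hu
    have hau : a ≤ u := le_min ht.le (H.time_mono (Nat.le_succ n) hn)
    have hmin : min t a = a := min_eq_right ht.le
    rw [hmin]
    have hsum : ∀ ω, H.summand B n t ω = H.value n ω * (B u ω - B a ω) := fun ω ↦ by
      rw [H.summand_eq_of_lt B ht]; rfl
    simp_rw [hsum]
    -- condition on `𝓕 a` and pull out `Hₙ²`
    obtain ⟨C, hC⟩ := H.bounded
    have hξ : StronglyMeasurable[𝓕 a] (fun ω ↦ H.value n ω ^ 2) :=
      (H.stronglyMeasurable_value (by omega)).pow 2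
    have hZ : Integrable (fun ω ↦ (B u ω - B a ω) ^ 2) μ := ((hB2 u).sub (hB2 a)).integrable_sq
    have hξZ : Integrable (fun ω ↦ H.value n ω ^ 2 * (B u ω - B a ω) ^ 2) μ := by
      refine hZ.bdd_mul (hξ.mono (𝓕.le a)).aestronglyMeasurable (c := C ^ 2)
        (ae_of_all _ fun ω ↦ ?_)
      rw [Real.norm_eq_abs, abs_pow, sq_abs]
      have h0 : 0 ≤ C := (abs_nonneg _).trans (hC n ω)
      nlinarith [hC n ω, abs_nonneg (H.value n ω), sq_abs (H.value n ω)]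
    have hpull := condExp_mul_of_stronglyMeasurable_left (μ := μ) hξ hξZ hZ
    have hcond := condExp_sub_sq_of_martingale_sq_sub hB hBsq hB2 hau
    calc ∫ ω, (H.value n ω * (B u ω - B a ω)) ^ 2 ∂μ
        = ∫ ω, H.value n ω ^ 2 * (B u ω - B a ω) ^ 2 ∂μ := by
          congr 1; ext ω; ring
      _ = ∫ ω, (μ[fun ω ↦ H.value n ω ^ 2 * (B u ω - B a ω) ^ 2 | 𝓕 a]) ω ∂μ :=
          (integral_condExp (𝓕.le a)).symm
      _ = ∫ ω, H.value n ω ^ 2 * ((u : ℝ) - a) ∂μ := by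
          refine integral_congr_ae ?_
          filter_upwards [hpull, hcond] with ω hω hω'
          rw [show (fun ω ↦ H.value n ω ^ 2 * (B u ω - B a ω) ^ 2) =
            (fun ω ↦ H.value n ω ^ 2) * fun ω ↦ (B u ω - B a ω) ^ 2 from rfl, hω,
            Pi.mul_apply, hω']

/-- Orthogonality of the last summand to the partial integral:
`E[(∑_{i<n} Yᵢ(t)) · Yₙ(t)] = 0` (the partial sum is `𝓕 tₙ`-measurable and
`E[Yₙ(t) | 𝓕 tₙ] = 0`).
Revuz–Yor, *Continuous Martingales and Brownian Motion* (1999), Ch. IV, proof of Thm (2.2).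
[folklore] -/
theorem integral_sum_summand_mul_summand (H : SimpleProcess m 𝓕) (hB : Martingale B 𝓕 μ)
    (hB2 : ∀ t, MemLp (B t) 2 μ) {n : ℕ} (hn : n + 1 < H.times.length) (t : ℝ≥0) :
    ∫ ω, (∑ i ∈ range n, H.summand B i t) ω * H.summand B n t ω ∂μ = 0 := by
  rcases le_or_gt t (H.time n) with ht | ht
  · simp [H.summand_eq_zero_of_le B hn ht]
  · set a := H.time n with ha
    have hS : StronglyMeasurable[𝓕 a] (∑ i ∈ range n, H.summand B i t) :=
      H.stronglyMeasurable_sum_summand hB.stronglyAdapted (by omega) t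
    have hSY : Integrable ((∑ i ∈ range n, H.summand B i t) * H.summand B n t) μ :=
      (H.memLp_sum_summand hB2 (by omega) t).integrable_mul
        (H.memLp_summand hB2 n (by omega) t)
    have hY : Integrable (H.summand B n t) μ := (H.martingale_summand hB hn).integrable t
    -- `E[Yₙ(t) | 𝓕 a] = Yₙ(a) = 0`
    have hYcond : μ[H.summand B n t | 𝓕 a] =ᵐ[μ] 0 := by
      have h := (H.martingale_summand hB hn).condExp_ae_eq ht.le
      rw [H.summand_eq_zero_of_le B hn le_rfl] at h
      exact h
    have hpull := condExp_mul_of_stronglyMeasurable_left (μ := μ) hS hSY hY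
    calc ∫ ω, (∑ i ∈ range n, H.summand B i t) ω * H.summand B n t ω ∂μ
        = ∫ ω, (μ[(∑ i ∈ range n, H.summand B i t) * H.summand B n t | 𝓕 a]) ω ∂μ :=
          (integral_condExp (𝓕.le a)).symm
      _ = ∫ ω, (0 : ℝ) ∂μ := by
          refine integral_congr_ae ?_
          filter_upwards [hpull, hYcond] with ω hω hω'
          rw [hω, Pi.mul_apply, hω', Pi.zero_apply, mul_zero]
      _ = 0 := by simp

/-- **Itô isometry for simple integrands** (sum form): `E[(H·B)_t²] = E[∑ᵢ Hᵢ² (t∧tᵢ₊₁ - t∧tᵢ)]`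
for a square-integrable martingale `B` with `B_t² - t` a martingale (induction on the number of
summands, using `integral_summand_sq` and the orthogonality `integral_sum_summand_mul_summand`).
Revuz–Yor, *Continuous Martingales and Brownian Motion* (1999), Ch. IV, Thm (2.2)
(`E[(K·M)²] = ‖K‖²_M`, proof p. 138). [cite: RevuzYor1999, Ch. IV Thm (2.2)] -/
theorem integral_integral_sq (H : SimpleProcess m 𝓕) (hB : Martingale B 𝓕 μ)
    (hBsq : Martingale (fun t ω ↦ B t ω ^ 2 - (t : ℝ)) 𝓕 μ) (hB2 : ∀ t, MemLp (B t) 2 μ)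
    (t : ℝ≥0) :
    ∫ ω, (H.integral B t ω) ^ 2 ∂μ =
      ∫ ω, ∑ i ∈ range (H.times.length - 1),
        H.value i ω ^ 2 * ((min t (H.time (i + 1)) : ℝ≥0) - (min t (H.time i) : ℝ≥0) : ℝ) ∂μ := by
  simp_rw [H.integral_apply_eq_sum_summand B t]
  -- induction over prefixes
  suffices h : ∀ n, n + 1 ≤ H.times.length →
      ∫ ω, (∑ i ∈ range n, H.summand B i t ω) ^ 2 ∂μ =
        ∫ ω, ∑ i ∈ range n,
          H.value i ω ^ 2 * ((min t (H.time (i + 1)) : ℝ≥0) - (min t (H.time i) : ℝ≥0) : ℝ) ∂μ by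
    rcases Nat.eq_zero_or_pos H.times.length with h0 | hpos
    · simp [h0]
    · exact h _ (by omega)
  intro n hn
  induction n with
  | zero => simp
  | succ n ih =>
    have ih' := ih (by omega)
    have hn' : n + 1 < H.times.length := by omega
    -- integrability of the pieces
    have hSm : MemLp (fun ω ↦ ∑ i ∈ range n, H.summand B i t ω) 2 μ := by
      have := H.memLp_sum_summand hB2 (n := n) (by omega) t
      convert this using 1; ext ω; simp [Finset.sum_apply]
    have hYm : MemLp (H.summand B n t) 2 μ := H.memLp_summand hB2 n (by omega) t
    have hS2 : Integrable (fun ω ↦ (∑ i ∈ range n, H.summand B i t ω) ^ 2) μ := hSm.integrable_sq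
    have hY2 : Integrable (fun ω ↦ H.summand B n t ω ^ 2) μ := hYm.integrable_sq
    have hSY : Integrable (fun ω ↦ (∑ i ∈ range n, H.summand B i t ω) * H.summand B n t ω) μ :=
      hSm.integrable_mul hYm
    have horth : ∫ ω, (∑ i ∈ range n, H.summand B i t ω) * H.summand B n t ω ∂μ = 0 := by
      have := H.integral_sum_summand_mul_summand hB hB2 hn' t
      simpa only [Finset.sum_apply] using this
    have hsq := H.integral_summand_sq hB hBsq hB2 hn' t
    -- the deterministic-coefficient terms are integrable
    obtain ⟨C, hC⟩ := H.bounded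
    have hterm : ∀ i, i < H.times.length → Integrable (fun ω ↦ H.value i ω ^ 2 *
        ((min t (H.time (i + 1)) : ℝ≥0) - (min t (H.time i) : ℝ≥0) : ℝ)) μ := by
      intro i hi
      refine Integrable.mul_const ?_ _
      refine (integrable_const (C ^ 2)).mono' (((H.stronglyMeasurable_value' hi).pow 2).aestronglyMeasurable)
        (ae_of_all _ fun ω ↦ ?_)
      rw [Real.norm_eq_abs, abs_pow, sq_abs]
      have h0 : 0 ≤ C := (abs_nonneg _).trans (hC i ω)
      nlinarith [hC i ω, abs_nonneg (H.value i ω), sq_abs (H.value i ω)]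
    have hsumInt : Integrable (fun ω ↦ ∑ i ∈ range n, H.value i ω ^ 2 *
        ((min t (H.time (i + 1)) : ℝ≥0) - (min t (H.time i) : ℝ≥0) : ℝ)) μ :=
      integrable_finsetSum _ fun i hi ↦ hterm i (by have := mem_range.1 hi; omega)
    have hA : Integrable (fun ω ↦ (∑ i ∈ range n, H.summand B i t ω) ^ 2 +
        2 * ((∑ i ∈ range n, H.summand B i t ω) * H.summand B n t ω)) μ :=
      hS2.add (hSY.const_mul 2)
    have hB' : Integrable (fun ω ↦ 2 * ((∑ i ∈ range n, H.summand B i t ω) * H.summand B n t ω)) μ :=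
      hSY.const_mul 2
    calc ∫ ω, (∑ i ∈ range (n + 1), H.summand B i t ω) ^ 2 ∂μ
        = ∫ ω, ((∑ i ∈ range n, H.summand B i t ω) ^ 2 +
            2 * ((∑ i ∈ range n, H.summand B i t ω) * H.summand B n t ω) +
            H.summand B n t ω ^ 2) ∂μ := by
          congr 1; ext ω; rw [sum_range_succ]; ring
      _ = ∫ ω, (∑ i ∈ range n, H.summand B i t ω) ^ 2 ∂μ +
            2 * ∫ ω, (∑ i ∈ range n, H.summand B i t ω) * H.summand B n t ω ∂μ +
            ∫ ω, H.summand B n t ω ^ 2 ∂μ := by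
          rw [integral_add hA hY2, integral_add hS2 hB', integral_const_mul]
      _ = ∫ ω, (∑ i ∈ range n, H.value i ω ^ 2 *
            ((min t (H.time (i + 1)) : ℝ≥0) - (min t (H.time i) : ℝ≥0) : ℝ)) ∂μ +
            ∫ ω, H.value n ω ^ 2 *
              ((min t (H.time (n + 1)) : ℝ≥0) - (min t (H.time n) : ℝ≥0) : ℝ) ∂μ := by
          rw [ih', horth, hsq, mul_zero, add_zero]
      _ = ∫ ω, ∑ i ∈ range (n + 1), H.value i ω ^ 2 *
            ((min t (H.time (i + 1)) : ℝ≥0) - (min t (H.time i) : ℝ≥0) : ℝ) ∂μ := by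
          rw [← integral_add hsumInt (hterm n (by omega))]
          congr 1; ext ω; rw [sum_range_succ]

/-- **Itô isometry for simple integrands** (time-integral form):
`E[(H·B)_t²] = E[∫₀ᵗ H(s)² ds]`.
Revuz–Yor, *Continuous Martingales and Brownian Motion* (1999), Ch. IV, Thm (2.2) and
Def. (2.1). [cite: RevuzYor1999, Ch. IV Thm (2.2)] -/
theorem integral_integral_sq_eq_setIntegral (H : SimpleProcess m 𝓕) (hB : Martingale B 𝓕 μ)
    (hBsq : Martingale (fun t ω ↦ B t ω ^ 2 - (t : ℝ)) 𝓕 μ) (hB2 : ∀ t, MemLp (B t) 2 μ)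
    (t : ℝ≥0) :
    ∫ ω, (H.integral B t ω) ^ 2 ∂μ =
      ∫ ω, (∫ s in Set.Icc (0 : ℝ) t, (H.toProcess s.toNNReal ω) ^ 2) ∂μ := by
  rw [H.integral_integral_sq hB hBsq hB2 t]
  congr 1; ext ω
  rw [H.setIntegral_toProcess_sq t ω]

end Isometry

end SimpleProcess

/-! ### The canonical Brownian motion -/

section Brownian

/-- Elementary integrals against the canonical Brownian motion are martingales for the raw
Brownian filtration under the pre-Wiener measure.
Revuz–Yor, *Continuous Martingales and Brownian Motion* (1999), Ch. IV, §2, after Def. (2.3).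
[folklore] -/
theorem SimpleProcess.martingale_integral_brownian
    (H : SimpleProcess (inferInstance : MeasurableSpace (ℝ≥0 → ℝ)) RandomPlanarGeometry.brownianFiltration) :
    Martingale (H.integral brownian) RandomPlanarGeometry.brownianFiltration preWienerMeasure := by
  haveI := RandomPlanarGeometry.isProbabilityMeasure_preWienerMeasure'
  exact H.martingale_integral RandomPlanarGeometry.martingale_brownian_holds

/-- Elementary integrals against the canonical Brownian motion are square integrable.
Revuz–Yor, *Continuous Martingales and Brownian Motion* (1999), Ch. IV, §2. [folklore] -/
theorem SimpleProcess.memLp_integral_brownian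
    (H : SimpleProcess (inferInstance : MeasurableSpace (ℝ≥0 → ℝ)) RandomPlanarGeometry.brownianFiltration) (t : ℝ≥0) :
    MemLp (H.integral brownian t) 2 preWienerMeasure :=
  H.memLp_integral RandomPlanarGeometry.memLp_two_brownian t

end Brownian

end Literature.Probability.Process
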